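import Literature.NumberTheory.EllipticCurves.AnalyticRankOverNumberFieldProofs
import Literature.NumberTheory.EllipticCurves.AnalyticRankOrderProofs
import Literature.NumberTheory.EllipticCurves.QuadraticTwistRank
import Literature.NumberTheory.EllipticCurves.MordellWeilTheoremProofs
import HarnessLib

/-!
# Crux `PlecticLegs.PlecticPointsLB` (stmt-BirchSwinnertonDyer-17518), line `conjugate-pigeonhole` —
# stub B `stub_balancedChart`: the balanced quadratic chart of the plectic regime at `d = 2`

Registered stub B of `Cruxes/PlecticPointsLB/Lines/sketch_conjugate_pigeonhole.lean` for crux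
stmt-BirchSwinnertonDyer-17518
(`Summit.BirchSwinnertonDyer.BirchSwinnertonDyer.Theses.PlecticLegs.PlecticPointsLB`, route
`PlecticLegs`): the balanced quadratic chart of the plectic regime at `d = 2`.

Let `E/ℚ` be an elliptic curve (`W : WeierstrassCurve ℚ`, `[W.IsElliptic]`), `K` a quadratic
number field (`Module.finrank ℚ K = 2`) of discriminant `d_K`, and `E^{(d_K)}` the quadratic twist
(`W.quadraticTwist d_K`). Suppose `L(E, s)` and `L(E^{(d_K)}, s)` have entire continuations, BOTH
vanish at `s = 1`, the Gross–Zagier–Kolyvagin implications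
`r_an ≤ 1 → r_an = rank` hold for `E` and for `E^{(d_K)}` (hypotheses), and
`r_an(E_K) = 2` for the base change `E_K = W.baseChange K`. Then `rank E(K) ≥ 2`.

## Proof

* Artin formalism for `[K : ℚ] = 2` (PROVED in tree,
  `WeierstrassCurve.analyticRankOver_eq_add_of_finrank_eq_two`):
  `r_an(E_K) = r_an(E) + r_an(E^{(d_K)})`, so the two analytic ranks over `ℚ` sum to `2`.
* Both factors vanish at `1`, so both analytic ranks are `≥ 1`
  (`WeierstrassCurve.analyticRank_eq_zero_iff_holds`); pigeonhole: both are EXACTLY `1`.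
* Gross–Zagier–Kolyvagin (the two hypotheses): `rank E(ℚ) = rank E^{(d_K)}(ℚ) = 1`.
* Rank additivity over a quadratic extension (PROVED in tree,
  `WeierstrassCurve.mordellWeilRank_baseChange_of_finrank_eq_two_of_finite`, with the Mordell–Weil
  theorem `WeierstrassCurve.module_finite_point_holds` for `E_K`):
  `rank E(K) = rank E(ℚ) + rank E^{(d_K)}(ℚ) = 2`.
-/

set_option linter.dupNamespace false -- single-conjunct summit: Sub = Summit (D-0017)

open scoped Classical

namespace Summit.BirchSwinnertonDyer.BirchSwinnertonDyer.Theorems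

/-- **Vanishing at `1` forces positive analytic rank.** For an elliptic curve `V` over a number
field whose `L`-function has an entire continuation vanishing at `s = 1`, `1 ≤ r_an(V)`
(contrapositive of `WeierstrassCurve.analyticRank_eq_zero_iff_holds`:
`r_an(V) = 0 ↔ L(V, 1) ≠ 0`). [folklore] -/
theorem balancedChart_one_le_analyticRank {F : Type*} [Field F] [NumberField F]
    (V : WeierstrassCurve F) [V.IsElliptic] (hV : V.HasEntireLFunction)
    (h0 : V.entireLFunction 1 = 0) : 1 ≤ V.analyticRank := by
  have hne : V.analyticRank ≠ 0 := fun h =>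
    ((V.analyticRank_eq_zero_iff_holds hV).mp h) h0
  omega

/-- **B · `stub_balancedChart` — the balanced quadratic chart of line `conjugate-pigeonhole` at
`d = 2`.** For an elliptic curve `E/ℚ`, a quadratic field `K` and the twist `E^{(d_K)}`: if
`L(E, s)` and `L(E^{(d_K)}, s)` are entire and both vanish at `s = 1`, the Gross–Zagier–Kolyvagin
implications `r_an ≤ 1 → r_an = rank` hold for `E` and `E^{(d_K)}`, and `r_an(E_K) = 2`, then
`rank E(K) ≥ 2`. Artin formalism `r_an(E_K) = r_an(E) + r_an(E^{(d_K)})`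
(`WeierstrassCurve.analyticRankOver_eq_add_of_finrank_eq_two`) and the two vanishings pin both
analytic ranks to `1`; Gross–Zagier–Kolyvagin gives both Mordell–Weil ranks `1`; rank additivity
over the quadratic extension (`WeierstrassCurve.mordellWeilRank_baseChange_of_finrank_eq_two_of_finite`,
Mordell–Weil `WeierstrassCurve.module_finite_point_holds`) gives `rank E(K) = 2`. [folklore] -/
theorem stub_balancedChart :
    ∀ (W : WeierstrassCurve ℚ) [W.IsElliptic] (K : Type) [Field K] [NumberField K],
      Module.finrank ℚ K = 2 →
      W.HasEntireLFunction → (W.quadraticTwist (NumberField.discr K : ℚ)).HasEntireLFunction →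
      W.entireLFunction 1 = 0 → (W.quadraticTwist (NumberField.discr K : ℚ)).entireLFunction 1 = 0 →
      (W.analyticRank ≤ 1 → W.analyticRank = W.mordellWeilRank) →
      ((W.quadraticTwist (NumberField.discr K : ℚ)).analyticRank ≤ 1 →
        (W.quadraticTwist (NumberField.discr K : ℚ)).analyticRank =
          (W.quadraticTwist (NumberField.discr K : ℚ)).mordellWeilRank) →
      (W.baseChange K).analyticRank = 2 → 2 ≤ (W.baseChange K).mordellWeilRank := by
  intro W _ K _ _ h2 hW hWd hW0 hWd0 hGZK hGZKd hran
  -- The twist by the (nonzero) discriminant is elliptic; the base change is elliptic and its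
  -- Mordell–Weil group is finitely generated (Mordell–Weil theorem).
  have hD : (NumberField.discr K : ℚ) ≠ 0 := by exact_mod_cast NumberField.discr_ne_zero K
  haveI := W.isElliptic_quadraticTwist hD
  haveI : (W.baseChange K).IsElliptic := inferInstanceAs (W.map (algebraMap ℚ K)).IsElliptic
  haveI : Module.Finite ℤ (W.baseChange K).toAffine.Point :=
    (W.baseChange K).module_finite_point_holds
  -- Artin formalism: `r_an(E_K) = r_an(E) + r_an(E^{(d_K)})`.
  have hsum : (W.baseChange K).analyticRank =
      W.analyticRank + (W.quadraticTwist (NumberField.discr K : ℚ)).analyticRank :=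
    W.analyticRankOver_eq_add_of_finrank_eq_two K h2 hW hWd
  -- Both factors vanish at `1`: both analytic ranks are `≥ 1`, hence exactly `1`.
  have h1 : 1 ≤ W.analyticRank := balancedChart_one_le_analyticRank W hW hW0
  have h1d : 1 ≤ (W.quadraticTwist (NumberField.discr K : ℚ)).analyticRank :=
    balancedChart_one_le_analyticRank _ hWd hWd0
  have hr : W.analyticRank = 1 := by omega
  have hrd : (W.quadraticTwist (NumberField.discr K : ℚ)).analyticRank = 1 := by omega
  -- Gross–Zagier–Kolyvagin for `E` and for `E^{(d_K)}`: both Mordell–Weil ranks are `1`.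
  have hmw : W.mordellWeilRank = 1 := by
    have := hGZK (by omega)
    omega
  have hmwd : (W.quadraticTwist (NumberField.discr K : ℚ)).mordellWeilRank = 1 := by
    have := hGZKd (by omega)
    omega
  -- Rank additivity over the quadratic extension: `rank E(K) = 1 + 1`.
  have hadd := W.mordellWeilRank_baseChange_of_finrank_eq_two_of_finite K h2
  omega

end Summit.BirchSwinnertonDyer.BirchSwinnertonDyer.Theorems
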